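import Summits.ValiantsHypothesis.ValiantsHypothesis.Theorems.MonotoneRestorationOrbitRestorationQPBlockProducts
import HarnessLib

/-!
# Two-level block products (sub-blocks with a common support) are orbit-restorable (ORBIT currency, XX)

Route MonotoneRestoration, crux `OrbitRestorationQP` (stmt-ValiantsHypothesis-18293), namespace
`Summit.ValiantsHypothesis.ValiantsHypothesis.Theorems.BlockProducts`.

The block criterion `qpOrbitRestorable_of_blocks` with one more level, as needed by KEYED blockings of
sign-twisted symmetric affine products (census of the seat, `Cruxes/OrbitRestorationQP/PISIGMA-SUBRUNG.md`): a
block `b` is now a multiset of SUB-BLOCKS, each a multiset of affine forms with a COMMON support of `≤ k`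
indices (so the sub-block's operand multiset has orbit `≤ (n+1)^k` with no condition on units), and it is the
multiset of SUB-BLOCK PRODUCTS that must be permuted exactly by the pointwise stabiliser of `≤ k` indices; the
block products are equivariant.  Then `a · Π_b Π_{N ∈ M_b} Π N` is `QPOrbitRestorable (k + 5)`
(`qpOrbitRestorable_of_blocks₂`).  Example of use: `Π_{i<j} Π_{K, p} (d_{k₁} − d_{k₂} + d_{k₃} − d_{k₄})`
(`d_k = x_ik − x_jk`, `K` a 4-set of columns, `p` a pairing of `K`): the three pairings of one `K` form a
`Sym(K)`-invariant sub-block although each single form is sign-twisted by the pairing swap.  Everything is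
proved. [folklore]
-/

noncomputable section

open scoped Classical

-- `Summit.ValiantsHypothesis.ValiantsHypothesis.…` is the tree's single-conjunct layout (Sub = Summit).
set_option linter.dupNamespace false

namespace Summit.ValiantsHypothesis.ValiantsHypothesis.Theorems

namespace BlockProducts

open Equiv Finset Literature.Computability.AlgebraicComplexity OrbitRestorationQPDepthThreeRung

variable {n : ℕ}

/-- **TWO-LEVEL EQUIVARIANT BLOCK PRODUCTS ARE ORBIT-RESTORABLE.**  Let `B` be a finite `Sym(Fin n)`-set and
`M_b` (`b ∈ B`) multisets of sub-blocks (multisets of affine forms) such that (i) every sub-block has a common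
support of `≤ k` indices, (ii) for every `b` the multiset of sub-block products `{Π N : N ∈ M_b}` is mapped to
itself exactly by the pointwise stabiliser of `≤ k` indices, (iii) `σ · Π_{N ∈ M_b} Π N = Π_{N ∈ M_{σ•b}} Π N`.
Then `a · Π_b Π_{N ∈ M_b} Π N` is `QPOrbitRestorable (k + 5)` at level `n`. [folklore; cite: DawarWilsenach2025, §3.3] -/
theorem qpOrbitRestorable_of_blocks₂ {k : ℕ} {B : Type} [Fintype B] [MulAction (Perm (Fin n)) B]
    (M : B → Multiset (Multiset (MvPolynomial (Fin n × Fin n) ℂ))) (a : ℂ)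
    (hAff : ∀ b, ∀ N ∈ M b, ∀ q ∈ N, q.totalDegree ≤ 1)
    (hSub : ∀ b, ∀ N ∈ M b, ∃ T : Finset (Fin n), T.card ≤ k ∧
      ∀ q ∈ N, ∀ σ : Perm (Fin n), (∀ x ∈ T, σ x = x) → ren σ q = q)
    (hPerm : ∀ b, ∃ K : Finset (Fin n), K.card ≤ k ∧
      ∀ σ : Perm (Fin n), (∀ x ∈ K, σ x = x) → ((M b).map Multiset.prod).map (ren σ) = (M b).map Multiset.prod)
    (hEqv : ∀ (σ : Perm (Fin n)) (b : B),
      ren σ ((M b).map Multiset.prod).prod = ((M (σ • b)).map Multiset.prod).prod) :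
    QPOrbitRestorable (k + 5) n (MvPolynomial.C a * ∏ b, ((M b).map Multiset.prod).prod) := by
  set L := Nat.log 2 n with hL
  set Bw := 2 ^ ((L + (k + 2)) ^ (k + 2)) with hBw
  have hBw1 : 1 ≤ Bw := Nat.one_le_two_pow
  have hpow : ∀ {j : ℕ}, j ≤ k → (n + 1) ^ j ≤ Bw := fun hj =>
    (Nat.pow_le_pow_right (Nat.succ_pos n) hj).trans (pow_succ_le_qp n k)
  -- the values
  set G : B → MvPolynomial (Fin n × Fin n) ℂ := fun b => ((M b).map Multiset.prod).prod with hG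
  set P : MvPolynomial (Fin n × Fin n) ℂ := ∏ b, G b with hP
  set f : MvPolynomial (Fin n × Fin n) ℂ := MvPolynomial.C a * P with hf
  set S0 : Finset (MvPolynomial (Fin n × Fin n) ℂ) :=
    insert (MvPolynomial.C 1) ((univ : Finset (Fin n × Fin n)).image MvPolynomial.X) with hS0
  set S1 : Finset (MvPolynomial (Fin n × Fin n) ℂ) := (univ : Finset B).biUnion fun b => (M b).join.toFinset
    with hS1
  set S2 : Finset (MvPolynomial (Fin n × Fin n) ℂ) :=
    (univ : Finset B).biUnion fun b => ((M b).map Multiset.prod).toFinset with hS2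
  set S3 : Finset (MvPolynomial (Fin n × Fin n) ℂ) := (univ : Finset B).image G with hS3
  set S : Finset (MvPolynomial (Fin n × Fin n) ℂ) := S0 ∪ S1 ∪ S2 ∪ S3 ∪ {P, f} with hS
  set rank : MvPolynomial (Fin n × Fin n) ℂ → ℕ := fun q =>
    if q ∈ S0 then 0 else if q ∈ S1 then 1 else if q ∈ S2 then 2 else if q ∈ S3 then 3 else if q = P then 4 else 5
    with hrank
  -- invariance of `P` and `f`
  have hPfix : ∀ σ : Perm (Fin n), ren σ P = P := by
    intro σ
    rw [hP, map_prod]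
    have hc : ∀ b, ren σ (G b) = G (σ • b) := fun b => hEqv σ b
    simp only [hc]
    exact Fintype.prod_equiv (MulAction.toPerm σ) _ _ fun b => rfl
  have hffix : ∀ σ : Perm (Fin n), ren σ f = f := fun σ => by rw [hf, map_mul, ren_C, hPfix]
  -- membership facts
  have hC1 : MvPolynomial.C 1 ∈ S0 := Finset.mem_insert_self _ _
  have hXm : ∀ p, MvPolynomial.X p ∈ S0 := fun p =>
    Finset.mem_insert_of_mem (Finset.mem_image.2 ⟨p, Finset.mem_univ p, rfl⟩)
  have hS0S : S0 ⊆ S := by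
    intro q hq; simp only [hS, Finset.mem_union]; exact Or.inl (Or.inl (Or.inl (Or.inl hq)))
  have hS1S : S1 ⊆ S := by
    intro q hq; simp only [hS, Finset.mem_union]; exact Or.inl (Or.inl (Or.inl (Or.inr hq)))
  have hS2S : S2 ⊆ S := by
    intro q hq; simp only [hS, Finset.mem_union]; exact Or.inl (Or.inl (Or.inr hq))
  have hS3S : S3 ⊆ S := by
    intro q hq; simp only [hS, Finset.mem_union]; exact Or.inl (Or.inr hq)
  have hPS : P ∈ S := by simp [hS]
  have hfS : f ∈ S := by simp [hS]
  have hmemS1 : ∀ b, ∀ N ∈ M b, ∀ q ∈ N, q ∈ S1 := fun b N hN q hq =>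
    Finset.mem_biUnion.2 ⟨b, Finset.mem_univ b, Multiset.mem_toFinset.2 (Multiset.mem_join.2 ⟨N, hN, hq⟩)⟩
  have hmemS2 : ∀ b, ∀ N ∈ M b, N.prod ∈ S2 := fun b N hN =>
    Finset.mem_biUnion.2 ⟨b, Finset.mem_univ b, Multiset.mem_toFinset.2 (Multiset.mem_map.2 ⟨N, hN, rfl⟩)⟩
  have hmemS3 : ∀ b, G b ∈ S3 := fun b => Finset.mem_image.2 ⟨b, Finset.mem_univ b, rfl⟩
  have hrank0 : ∀ q ∈ S0, rank q = 0 := fun q hq => by simp only [hrank, if_pos hq]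
  have hrank1 : ∀ q ∈ S1, rank q ≤ 1 := fun q hq => by
    simp only [hrank]; split_ifs <;> omega
  have hrank2 : ∀ q ∈ S2, rank q ≤ 2 := fun q hq => by
    simp only [hrank]; split_ifs <;> omega
  have hrank3 : ∀ q ∈ S3, rank q ≤ 3 := fun q hq => by
    simp only [hrank]; split_ifs <;> omega
  have hrankP : rank P ≤ 4 := by simp only [hrank]; split_ifs <;> omega
  -- orbit of an invariant
  have horb_inv : ∀ {q : MvPolynomial (Fin n × Fin n) ℂ}, (∀ σ : Perm (Fin n), ren σ q = q) →
      (Set.range fun σ : Perm (Fin n) => ren σ q).ncard ≤ Bw := fun hq =>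
    (ValueOrbit.ncard_orbit_of_invariant hq).trans hBw1
  -- THE WIDTH STATEMENT
  have W : ∀ q ∈ S, (Set.range fun σ : Perm (Fin n) => ren σ q).ncard ≤ Bw ∧
      ∃ d : WStep ℂ (Fin n × Fin n), d.Valid S rank q ∧
        ∀ N, d = WStep.prod N → (Set.range fun σ : Perm (Fin n) => N.map (ren σ)).ncard ≤ Bw := by
    intro q hq
    by_cases h0 : q ∈ S0
    · rcases Finset.mem_insert.1 h0 with rfl | hx
      · refine ⟨horb_inv fun σ => ren_C σ 1, WStep.const 1, ⟨rfl, fun u hu => by simp [WStep.args] at hu⟩,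
          fun N h => by cases h⟩
      · obtain ⟨p, -, rfl⟩ := Finset.mem_image.1 hx
        refine ⟨?_, WStep.var p, ⟨rfl, fun u hu => by simp [WStep.args] at hu⟩, fun N h => by cases h⟩
        refine le_trans ?_ ((ValueOrbit.ncard_orbit_var_le n p).trans (sq_le_qp n k))
        exact TermCircuit.ncard_range_le_of_factor _ (fun σ : Perm (Fin n) => σ • p) MvPolynomial.X
          fun σ => ren_X σ p
    by_cases h1 : q ∈ S1
    · -- an affine form of some sub-block
      obtain ⟨b, -, hqb⟩ := Finset.mem_biUnion.1 h1
      obtain ⟨N, hN, hqN⟩ := Multiset.mem_join.1 (Multiset.mem_toFinset.1 hqb)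
      have hrq : rank q = 1 := by simp only [hrank, if_neg h0, if_pos h1]
      refine ⟨?_, WStep.sum ((MvPolynomial.coeff 0 q, MvPolynomial.C 1) ::ₘ
        ((univ : Finset (Fin n × Fin n)).val.map fun p => (MvPolynomial.coeff (Finsupp.single p 1) q,
          MvPolynomial.X p))), ⟨?_, fun u hu => ?_⟩, fun N h => by cases h⟩
      · obtain ⟨T, hTk, hT⟩ := hSub b N hN
        exact (ValueOrbit.orbit_bounded_of_supported (hT q hqN)).trans (hpow hTk)
      · rw [WStep.value, Multiset.map_cons, Multiset.sum_cons, Multiset.map_map, map_one, mul_one]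
        conv_rhs => rw [eqvTerms_affine_eq q (hAff b N hN q hqN), Finset.sum_eq_multiset_sum]
        rfl
      · simp only [WStep.args, Multiset.map_cons, Multiset.map_map, Function.comp_def, Multiset.mem_cons,
          Multiset.mem_map, Finset.mem_val, Finset.mem_univ, true_and] at hu
        have hu0 : u ∈ S0 := by
          rcases hu with rfl | ⟨p, rfl⟩
          · exact hC1
          · exact hXm p
        exact ⟨hS0S hu0, by rw [hrank0 u hu0, hrq]; exact Nat.zero_lt_one⟩
    by_cases h2 : q ∈ S2
    · -- a sub-block product: operand multiset of commonly supported forms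
      obtain ⟨b, -, hqb⟩ := Finset.mem_biUnion.1 h2
      obtain ⟨N, hN, rfl⟩ := Multiset.mem_map.1 (Multiset.mem_toFinset.1 hqb)
      obtain ⟨T, hTk, hT⟩ := hSub b N hN
      have hNfix : ∀ σ : Perm (Fin n), (∀ x ∈ T, σ x = x) → N.map (ren σ) = N := fun σ hσ => by
        conv_rhs => rw [← Multiset.map_id N]
        exact Multiset.map_congr rfl fun q hq => hT q hq σ hσ
      have hrq : rank N.prod = 2 := by simp only [hrank, if_neg h0, if_neg h1, if_pos h2]
      refine ⟨(ValueOrbit.orbit_bounded_of_supported (ren_prod_eq_of_perm hNfix)).trans (hpow hTk),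
        WStep.prod N, ⟨rfl, fun u hu => ?_⟩, fun N' h => ?_⟩
      · have hu1 : u ∈ S1 := hmemS1 b N hN u hu
        exact ⟨hS1S hu1, by rw [hrq]; exact Nat.lt_of_le_of_lt (hrank1 u hu1) (by norm_num)⟩
      · cases h
        exact (ncard_range_map_le_of_perm hNfix).trans (hpow hTk)
    by_cases h3 : q ∈ S3
    · -- a block product: operand multiset of sub-block products, exactly permuted
      obtain ⟨b, -, rfl⟩ := Finset.mem_image.1 h3
      obtain ⟨K, hKk, hK⟩ := hPerm b
      have hrq : rank (G b) = 3 := by simp only [hrank, if_neg h0, if_neg h1, if_neg h2, if_pos h3]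
      refine ⟨(ValueOrbit.orbit_bounded_of_supported (ren_prod_eq_of_perm hK)).trans (hpow hKk),
        WStep.prod ((M b).map Multiset.prod), ⟨rfl, fun u hu => ?_⟩, fun N h => ?_⟩
      · rw [WStep.args] at hu
        obtain ⟨N, hN, rfl⟩ := Multiset.mem_map.1 hu
        have hu2 : N.prod ∈ S2 := hmemS2 b N hN
        exact ⟨hS2S hu2, by rw [hrq]; exact Nat.lt_of_le_of_lt (hrank2 _ hu2) (by norm_num)⟩
      · cases h
        exact (ncard_range_map_le_of_perm hK).trans (hpow hKk)
    by_cases h4 : q = P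
    · subst h4
      have hrq : rank P = 4 := by simp only [hrank, if_neg h0, if_neg h1, if_neg h2, if_neg h3, if_true]
      set N₀ : Multiset (MvPolynomial (Fin n × Fin n) ℂ) := (univ : Finset B).val.map G with hN₀
      have hN₀fix : ∀ σ : Perm (Fin n), N₀.map (ren σ) = N₀ := by
        intro σ
        rw [hN₀, Multiset.map_map]
        have hc : (ren σ) ∘ G = G ∘ (MulAction.toPerm σ) := by
          funext b; simp only [Function.comp_apply, MulAction.toPerm_apply]; exact hEqv σ b
        rw [hc, ← Multiset.map_map, Multiset.map_univ_val_equiv]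
      refine ⟨horb_inv hPfix, WStep.prod N₀, ⟨?_, fun u hu => ?_⟩, fun N h => ?_⟩
      · rw [WStep.value, hN₀, hP, Finset.prod_eq_multiset_prod]
      · rw [WStep.args, hN₀] at hu
        simp only [Multiset.mem_map, Finset.mem_val, Finset.mem_univ, true_and] at hu
        obtain ⟨b, rfl⟩ := hu
        exact ⟨hS3S (hmemS3 b), by rw [hrq]; exact Nat.lt_of_le_of_lt (hrank3 _ (hmemS3 b)) (by norm_num)⟩
      · cases h
        rw [show (Set.range fun σ : Perm (Fin n) => N₀.map (ren σ)) = {N₀} from ?_]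
        · rw [Set.ncard_singleton]; exact hBw1
        · ext N; simp only [Set.mem_range, hN₀fix, Set.mem_singleton_iff, exists_const, eq_comm]
    · have hqf : q = f := by
        simp only [hS, Finset.mem_union, Finset.mem_insert, Finset.mem_singleton] at hq
        rcases hq with (((hq | hq) | hq) | hq) | hq | hq
        · exact absurd hq h0
        · exact absurd hq h1
        · exact absurd hq h2
        · exact absurd hq h3
        · exact absurd hq h4
        · exact hq
      subst hqf
      have hrq : rank f = 5 := by simp only [hrank, if_neg h0, if_neg h1, if_neg h2, if_neg h3, if_neg h4]
      refine ⟨horb_inv hffix, WStep.sum ((a, P) ::ₘ 0), ⟨?_, fun u hu => ?_⟩, fun N h => by cases h⟩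
      · simp only [WStep.value, Multiset.map_cons, Multiset.map_zero, Multiset.sum_cons, Multiset.sum_zero,
          add_zero, hf]
      · simp only [WStep.args, Multiset.map_cons, Multiset.map_zero, Multiset.mem_cons,
          Multiset.notMem_zero, or_false] at hu
        subst hu
        exact ⟨hPS, by rw [hrq]; exact Nat.lt_of_le_of_lt hrankP (by norm_num)⟩
  let 𝒲 : WideDerivation ℂ (Fin n × Fin n) :=
    { S := S, rank := rank, step := fun q hq => by
        obtain ⟨-, d, hd, -⟩ := W q hq
        exact ⟨d, hd⟩ }
  have hW : 𝒲.OrbitWidthLE (Perm (Fin n)) Bw := fun q hq => W q hq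
  obtain ⟨Gt, inst, C, hC, hev, horb⟩ := ValueOrbit.qpOrbit_of_wide (c := k + 2) 𝒲 hfS hffix hW
  exact ⟨Gt, inst, C, hC, hev, horb⟩

end BlockProducts

end Summit.ValiantsHypothesis.ValiantsHypothesis.Theorems

end
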